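import Literature.NumberTheory.EllipticCurves.SzpiroFreyCurveProofs
import Literature.NumberTheory.EllipticCurves.ModularDegreeFormulaProofs
import Literature.NumberTheory.EllipticCurves.EichlerShimuraConstructionProofs
import Literature.NumberTheory.EllipticCurves.ComplexPeriod
import Literature.NumberTheory.DiophantineGeometry.EllArithGlueMinimalProofs
import Literature.NumberTheory.DiophantineGeometry.MinimalDiscriminantRingOfIntegersProofs
import Mathlib.NumberTheory.Padics.HeightOneSpectrum
import HarnessLib

/-!
# The modular degree conjecture for Frey curves implies abc — preliminaries

Topic `Literature/NumberTheory/EllipticCurves` (family `abc`). Theorems only (no definition, no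
named fact): the lemmas of the reduction "Frey's degree conjecture on the Frey–Hellegouarch curves
`E_{a,b} : y² = x(x − a)(x + b)` ⟹ the abc conjecture" (Frey 1987/1989; Mai–Murty 1994;
M. R. Murty, *Bounds for congruence primes* (1999), Thm. 1; reviewed in Pasten,
*Shimura curves and the abc conjecture*, arXiv:1705.09251 = JNT 254 (2024), §3), assembled in
`Literature/NumberTheory/EllipticCurves/DegreeConjectureAbc.lean`.

## Contents

* `isMinimalAt_iff_isMinimal_padic`, `isMinimalAt_iff_of_primesEquiv_eq`,
  `isGloballyMinimal_of_forall_isMinimalAt_int` — bookkeeping between the two indexings of the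
  finite places of `ℚ` used in the tree: the Frey-curve files (`SzpiroFreyProofs`: the global
  minimal equations (12.17), (12.18) of Bombieri–Gubler Ex. 12.5.10) prove minimality at the places
  of `ℤ`, while `WeierstrassCurve.IsGloballyMinimal` (consumed by Silverman's covolume inequality
  `silverman1986_discriminant_c4_covolume`) is indexed by the places of `𝓞 ℚ`. Both are minimality
  of `W ⊗ ℚ_p` over `ℤ_p` (transport along Mathlib's `Rat.HeightOneSpectrum.padicEquiv`,
  `padicIntEquiv`, with the tree's `WeierstrassCurve.isMinimal_map_ringEquiv`).
* `covolume_ge_of_zagier`, `covolume_neronLattice_ge_of_deg_le` — the Frey–Murty inequality: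
  Zagier's identity `4π² c² (f,f) = deg φ · covol(Λ)` (PROVED in the tree,
  `ModularParametrizationData.zagier_degree_formula_holds`), a degree bound
  `deg φ ≤ C₁ c² N^{2+δ}` and a Petersson lower bound `c₂ N^{1−δ} ≤ (f,f)` give
  `covol(Λ) ≥ (4π² c₂/C₁) N^{−(1+2δ)}`; the Manin constant `c` cancels. In the language of heights
  (`h(E) = −½ log covol(Λ_Néron)`, Silverman 1986 (14); Pasten §3) this is
  `h(E) ≤ ½ log deg φ − ½ log N + O_δ(1) + δ log N`, Pasten's (3.2) sharpened by the Petersson bound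
  as in Murty 1999 (Pasten, remark after (3.2): "as pointed out in [MurtyBounds], one has
  `2 log ‖f‖ ∼ log N`").
* `exponent_le`, `pow_six_le_of_estimates`, `le_of_pow_six_le` — real-arithmetic bookkeeping
  (`(1+2δ)(6+δ) ≤ 6(1+ε)` for `δ = min(1, ε/3)`; sixth roots).
* `estimates_of_frey_pair` — for one Frey pair `(A, B)` and a global minimal equation `W₀` of
  `E_{A,B}` reached by a change of variables with `|u| ≥ 1`: the covolume bound above for the
  lattice `Λ` of the parametrisation datum, `covol(Λ_Néron(W₀)) = |u|² covol(Λ) ≥ covol(Λ)`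
  (`IsNeronLatticeOf.smul`, `PeriodPair.covolume_mulLeft_lattice`), and Silverman's inequality for
  `W₀`: `|c₄(W₀)|³ ≤ A covol(Λ_Néron(W₀))^{−(6+δ)}`.

## Design notes

* The two analytic inputs are threaded as explicit hypotheses in the *shape* of the named facts
  `Literature.NumberTheory.EllipticCurves.ModularForms.murty_petersson_newform_lower_bound` and
  `Literature.NumberTheory.EllipticCurves.ModularForms.silverman1986_discriminant_c4_covolume`
  (already instantiated at the working `δ`), so that this file does not depend on those two
  statement files; the assembling file feeds the facts in.
* No Faltings height is defined: everything is stated through `ZLattice.covolume` of Néron-type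
  period lattices (`IsNeronLatticeOf`), as in `ModularDegreeFormula.lean` and
  `SilvermanHeightCovolume.lean`.

## References

* M. R. Murty, *Bounds for congruence primes*, Proc. Sympos. Pure Math. 66.1 (1999) 177–192,
  Thm. 1. [MurtyCongruencePrimes1999] (not held; statement as reported by Pasten, Rem. 3.3;
  acquisition request acq-02076.)
* H. Pasten, *Shimura curves and the abc conjecture*, J. Number Theory 254 (2024) 214–335 =
  arXiv:1705.09251, §3 (pp. 13–14: (3.1), (3.2), Conj. 3.1, 3.2, Rem. 3.3; read). [PastenShimura2024]
* G. Frey, *On ternary equations of Fermat type and relations with elliptic curves*, in: Modular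
  Forms and Fermat's Last Theorem (1997), §3: Lemma 3.1, Prop. 3.1, Cor. 3.1 (read).
  [Frey1997Ternary]
* G. Frey, *Links between solutions of A − B = C and elliptic curves*, LNM 1380 (1989). [Frey1989]
* D. Zagier, *Modular parametrizations of elliptic curves*, Canad. Math. Bull. 28 (1985), §1.
  [ZagierCMB1985]
* J. H. Silverman, *Heights and elliptic curves*, in: Arithmetic Geometry (1986), Prop. 1.1,
  Cor. 2.3, Prop. 3.1 (read). [Silverman1986]
* E. Bombieri, W. Gubler, *Heights in Diophantine Geometry* (2006), Ex. 12.5.10, Thm. 12.5.12.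
  [BombieriGubler2006]
-/

noncomputable section

open IsDedekindDomain WeierstrassCurve NumberField

namespace Literature.NumberTheory.EllipticCurves

/-! ### Minimality at the places of `ℤ` versus the places of `𝓞 ℚ` -/

section Transport

open Rat.HeightOneSpectrum Literature.NumberTheory.DiophantineGeometry.MinimalDiscriminant

variable {R : Type*} [CommRing R] [IsDedekindDomain R] [Algebra R ℚ] [IsFractionRing R ℚ]
  [IsIntegralClosure R ℤ ℚ]

/-- Minimality of `W / ℚ` at a place `v` of an integer ring `R` of `ℚ` (`R = ℤ` or `R = 𝓞 ℚ`),
computed in Mathlib's `p`-adic numbers, `p` the prime below `v`: transport of Mathlib's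
`WeierstrassCurve.IsMinimal` along `v.adicCompletion ℚ ≃A[ℚ] ℚ_[p]`,
`v.adicCompletionIntegers ℚ ≃A[ℤ] ℤ_[p]` (`WeierstrassCurve.isMinimal_map_ringEquiv`).
Silverman, AEC VII.1 (minimality only involves `ord_v`). [folklore] -/
theorem isMinimalAt_iff_isMinimal_padic (v : HeightOneSpectrum R) (p : ℕ) [Fact p.Prime]
    (hp : ((primesEquiv v : Nat.Primes) : ℕ) = p) (W : WeierstrassCurve ℚ) :
    W.IsMinimalAt v ↔ (W.baseChange ℚ_[p]).IsMinimal ℤ_[p] := by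
  subst hp
  have hc : ∀ r : v.adicCompletionIntegers ℚ,
      (adicCompletion.padicEquiv v).toRingEquiv (algebraMap _ (v.adicCompletion ℚ) r) =
        algebraMap ℤ_[primesEquiv v] ℚ_[primesEquiv v]
          ((adicCompletionIntegers.padicIntEquiv v).toRingEquiv r) := fun r ↦ rfl
  have hmap : (W.baseChange (v.adicCompletion ℚ)).map
      ((adicCompletion.padicEquiv v).toRingEquiv : v.adicCompletion ℚ →+* ℚ_[primesEquiv v]) =
        W.baseChange ℚ_[primesEquiv v] := by
    rw [baseChange, baseChange, map_map]
    congr 1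
    exact Subsingleton.elim _ _
  have hmap' : (W.baseChange ℚ_[primesEquiv v]).map
      ((adicCompletion.padicEquiv v).toRingEquiv.symm : ℚ_[primesEquiv v] →+* v.adicCompletion ℚ) =
        W.baseChange (v.adicCompletion ℚ) := by
    rw [baseChange, baseChange, map_map]
    congr 1
    exact Subsingleton.elim _ _
  constructor
  · intro h
    haveI : (W.baseChange (v.adicCompletion ℚ)).IsMinimal (v.adicCompletionIntegers ℚ) := h
    have := isMinimal_map_ringEquiv (adicCompletionIntegers.padicIntEquiv v).toRingEquiv
      (adicCompletion.padicEquiv v).toRingEquiv hc (W.baseChange (v.adicCompletion ℚ))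
    rwa [hmap] at this
  · intro h
    haveI := h
    have := isMinimal_map_ringEquiv (adicCompletionIntegers.padicIntEquiv v).toRingEquiv.symm
      (adicCompletion.padicEquiv v).toRingEquiv.symm (ringEquiv_compat_symm _ _ hc)
      (W.baseChange ℚ_[primesEquiv v])
    rw [hmap'] at this
    exact this

/-- Minimality of `W / ℚ` at places `v`, `v'` of two integer rings of `ℚ` above the same prime
agree (both are minimality of `W ⊗ ℚ_p` over `ℤ_p`). [folklore] -/
theorem isMinimalAt_iff_of_primesEquiv_eq {R' : Type*} [CommRing R'] [IsDedekindDomain R']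
    [Algebra R' ℚ] [IsFractionRing R' ℚ] [IsIntegralClosure R' ℤ ℚ]
    (v : HeightOneSpectrum R) (v' : HeightOneSpectrum R') (W : WeierstrassCurve ℚ)
    (h : ((primesEquiv v : Nat.Primes) : ℕ) = primesEquiv v') :
    W.IsMinimalAt v ↔ W.IsMinimalAt v' := by
  haveI : Fact ((primesEquiv v' : Nat.Primes) : ℕ).Prime := ⟨(primesEquiv v').2⟩
  rw [isMinimalAt_iff_isMinimal_padic v _ h W, isMinimalAt_iff_isMinimal_padic v' _ rfl W]

/-- **A Weierstrass equation over `ℚ` which is minimal at every prime `p` (place of `ℤ`) is a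
global minimal equation** (`WeierstrassCurve.IsGloballyMinimal`, stated with the places of
`𝓞 ℚ`): the places correspond along `Rat.HeightOneSpectrum.primesEquiv`, minimality is a
condition in `ℚ_p` (`isMinimalAt_iff_of_primesEquiv_eq`), and integrality over `𝓞 ℚ` follows from
minimality everywhere (`WeierstrassCurve.isGloballyMinimal_iff_forall_isMinimalAt_holds`).
Silverman, AEC VIII.8 (definition of a global minimal equation). [folklore] -/
theorem isGloballyMinimal_of_forall_isMinimalAt_int (W : WeierstrassCurve ℚ)
    (h : ∀ v : HeightOneSpectrum ℤ, W.IsMinimalAt v) : W.IsGloballyMinimal := by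
  refine (isGloballyMinimal_iff_forall_isMinimalAt_holds W).mpr fun v ↦ ?_
  set v₀ : HeightOneSpectrum ℤ := (primesEquiv (R := ℤ)).symm (primesEquiv v) with hv₀
  have h0 : ((primesEquiv v : Nat.Primes) : ℕ) = primesEquiv v₀ := by
    rw [hv₀, Equiv.apply_symm_apply]
  exact (isMinimalAt_iff_of_primesEquiv_eq v v₀ W h0).mpr (h v₀)

end Transport

/-! ### The covolume of the Néron lattice from the modular degree (Frey; Murty 1999) -/

section Covolume

open ModularForms CongruenceSubgroup

/-- **The Frey–Murty inequality, real-arithmetic core.** From Zagier's identity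
`4π² c² (f,f) = deg φ · covol(Λ)`, a degree bound `deg φ ≤ C₁ c² N^{2+δ}` and a Petersson lower
bound `c₂ N^{1−δ} ≤ (f,f)`, the covolume of the period lattice is at least
`(4π² c₂ / C₁) · N^{−(1+2δ)}` (the Manin constant cancels). Murty 1999 (as quoted by Pasten,
arXiv:1705.09251, §3): `h(E) ≤ ½ log deg φ − log‖f‖ + O(1)`. [folklore] -/
theorem covolume_ge_of_zagier {P deg covol c C₁ c₂ N δ : ℝ} (hN : 0 < N) (hC₁ : 0 < C₁)
    (hc : c ≠ 0) (hcov : 0 < covol)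
    (hZ : 4 * Real.pi ^ 2 * c ^ 2 * P = deg * covol)
    (hdeg : deg ≤ C₁ * c ^ 2 * N ^ (2 + δ)) (hP : c₂ * N ^ (1 - δ) ≤ P) :
    4 * Real.pi ^ 2 * c₂ / C₁ * N ^ (-(1 + 2 * δ)) ≤ covol := by
  have hc2 : 0 < c ^ 2 := by positivity
  have hNe : 0 < N ^ (2 + δ) := Real.rpow_pos_of_pos hN _
  -- `4π² c² c₂ N^{1-δ} ≤ 4π² c² P = deg covol ≤ C₁ c² N^{2+δ} covol`
  have h1 : 4 * Real.pi ^ 2 * c ^ 2 * (c₂ * N ^ (1 - δ)) ≤ C₁ * c ^ 2 * N ^ (2 + δ) * covol := by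
    calc 4 * Real.pi ^ 2 * c ^ 2 * (c₂ * N ^ (1 - δ))
        ≤ 4 * Real.pi ^ 2 * c ^ 2 * P := by gcongr
      _ = deg * covol := hZ
      _ ≤ C₁ * c ^ 2 * N ^ (2 + δ) * covol := by gcongr
  -- cancel `c²` and rearrange
  have h2 : 4 * Real.pi ^ 2 * c₂ * N ^ (1 - δ) ≤ C₁ * N ^ (2 + δ) * covol := by
    have := div_le_div_of_nonneg_right h1 hc2.le
    rwa [show 4 * Real.pi ^ 2 * c ^ 2 * (c₂ * N ^ (1 - δ)) / c ^ 2 =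
        4 * Real.pi ^ 2 * c₂ * N ^ (1 - δ) by field_simp,
      show C₁ * c ^ 2 * N ^ (2 + δ) * covol / c ^ 2 = C₁ * N ^ (2 + δ) * covol by
        field_simp] at this
  have hsplit : N ^ (-(1 + 2 * δ)) = N ^ (1 - δ) / N ^ (2 + δ) := by
    rw [← Real.rpow_sub hN]; congr 1; ring
  rw [hsplit, show 4 * Real.pi ^ 2 * c₂ / C₁ * (N ^ (1 - δ) / N ^ (2 + δ)) =
      4 * Real.pi ^ 2 * c₂ * N ^ (1 - δ) / (C₁ * N ^ (2 + δ)) by field_simp,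
    div_le_iff₀ (mul_pos hC₁ hNe)]
  linarith [h2]

variable {a b : ℤ} {N : ℕ} [NeZero N]

/-- **Frey–Murty: a degree bound gives a lower bound for the covolume of the period lattice.**
For a modular parametrisation datum `D` of the Frey curve `y² = x(x − a)(x + b)` at level `N`
(Néron-type lattice `Λ = D.L.lattice` of this model, Manin constant `c`, degree `deg`), Zagier's
formula `4π² c² (f,f) = deg · covol(Λ)` (`zagier_degree_formula_holds`, proved in the tree),
`deg ≤ C₁ c² N^{2+δ}` and `c₂ N^{1−δ} ≤ (f,f)` give `covol(Λ) ≥ (4π² c₂/C₁) N^{−(1+2δ)}`.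
This is the step "`h(E) ≤ ½ log deg φ − ½ log N + o(log N)`" of Murty 1999 (Pasten,
arXiv:1705.09251, §3, eq. (3.2) with the remark after it). [cite: PastenShimura2024, §3 (3.2)] -/
theorem covolume_neronLattice_ge_of_deg_le
    (D : ModularParametrizationData (freyCurve a b) N) {C₁ c₂ δ : ℝ} (hC₁ : 0 < C₁)
    (hdeg : (D.deg : ℝ) ≤ C₁ * (D.c : ℝ) ^ 2 * (N : ℝ) ^ (2 + δ))
    (hP : c₂ * (N : ℝ) ^ (1 - δ) ≤ (peterssonProduct (Gamma0 N) 2 D.f D.f).re) :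
    4 * Real.pi ^ 2 * c₂ / C₁ * (N : ℝ) ^ (-(1 + 2 * δ)) ≤ ZLattice.covolume D.L.lattice := by
  have hN : (0 : ℝ) < N := by exact_mod_cast Nat.pos_of_ne_zero (NeZero.ne N)
  have hc0 : D.maninConstant ≠ 0 := D.maninConstant_ne_zero_holds
  have hc : (D.c : ℝ) ≠ 0 := by exact_mod_cast hc0
  have hcov : 0 < ZLattice.covolume D.L.lattice := ZLattice.covolume_pos _ _
  have hZ := congrArg Complex.re D.zagier_degree_formula_holds
  rw [Complex.re_ofReal_mul, Complex.ofReal_re] at hZ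
  exact covolume_ge_of_zagier hN hC₁ hc hcov hZ hdeg hP

end Covolume

/-! ### Real-arithmetic bookkeeping -/

section Arithmetic

/-- The exponent bookkeeping: for `0 < δ ≤ 1` with `3δ ≤ ε`,
`(1 + 2δ)(6 + δ) ≤ 6 (1 + ε)`. [folklore] -/
theorem exponent_le {δ ε : ℝ} (hδ : 0 < δ) (hδ1 : δ ≤ 1) (hδε : 3 * δ ≤ ε) :
    (1 + 2 * δ) * (6 + δ) ≤ 6 * (1 + ε) := by
  nlinarith

/-- **From the covolume to `c`.** If `c² ≤ 2 |c₄'|`, `|c₄'|³ ≤ A · covol'^{−(6+δ)}`,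
`covol ≤ covol'`, `κ N^{−(1+2δ)} ≤ covol` and `N ≤ 2¹⁰ R` with `R ≥ 1`, then
`c⁶ ≤ 8 A κ^{−(6+δ)} 2^{10 (1+2δ)(6+δ)} · R^{(1+2δ)(6+δ)}`. [folklore] -/
theorem pow_six_le_of_estimates {c c₄ A covol covol' κ N R δ : ℝ} (hδ : 0 < δ) (hA : 0 ≤ A)
    (hκ : 0 < κ) (hN : 0 < N) (hcov : 0 < covol)
    (hc : c ^ 2 ≤ 2 * c₄) (hc₄ : c₄ ^ 3 ≤ A * covol' ^ (-(6 + δ))) (hcc : covol ≤ covol')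
    (hlow : κ * N ^ (-(1 + 2 * δ)) ≤ covol) (hNR : N ≤ 2 ^ 10 * R) (hR : 1 ≤ R) :
    c ^ 6 ≤ 8 * A * κ ^ (-(6 + δ)) * (2 ^ 10) ^ ((1 + 2 * δ) * (6 + δ)) *
      R ^ ((1 + 2 * δ) * (6 + δ)) := by
  have hexp : -(6 + δ) ≤ 0 := by linarith
  have hlow0 : 0 < κ * N ^ (-(1 + 2 * δ)) := mul_pos hκ (Real.rpow_pos_of_pos hN _)
  -- `covol'^{-(6+δ)} ≤ covol^{-(6+δ)} ≤ (κ N^{-(1+2δ)})^{-(6+δ)}`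
  have h1 : covol' ^ (-(6 + δ)) ≤ covol ^ (-(6 + δ)) :=
    Real.rpow_le_rpow_of_nonpos hcov hcc hexp
  have h2 : covol ^ (-(6 + δ)) ≤ (κ * N ^ (-(1 + 2 * δ))) ^ (-(6 + δ)) :=
    Real.rpow_le_rpow_of_nonpos hlow0 hlow hexp
  have h3 : (κ * N ^ (-(1 + 2 * δ))) ^ (-(6 + δ)) =
      κ ^ (-(6 + δ)) * N ^ ((1 + 2 * δ) * (6 + δ)) := by
    rw [Real.mul_rpow hκ.le (Real.rpow_nonneg hN.le _), ← Real.rpow_mul hN.le]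
    congr 1; ring
  have h4 : N ^ ((1 + 2 * δ) * (6 + δ)) ≤ (2 ^ 10 * R) ^ ((1 + 2 * δ) * (6 + δ)) :=
    Real.rpow_le_rpow hN.le hNR (by positivity)
  have h5 : (2 ^ 10 * R : ℝ) ^ ((1 + 2 * δ) * (6 + δ)) =
      (2 ^ 10) ^ ((1 + 2 * δ) * (6 + δ)) * R ^ ((1 + 2 * δ) * (6 + δ)) :=
    Real.mul_rpow (by positivity) (by linarith)
  have hc₄0 : 0 ≤ c₄ := by nlinarith [sq_nonneg c]
  have hκe : 0 ≤ κ ^ (-(6 + δ)) := Real.rpow_nonneg hκ.le _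
  calc c ^ 6 = (c ^ 2) ^ 3 := by ring
    _ ≤ (2 * c₄) ^ 3 := pow_le_pow_left₀ (sq_nonneg c) hc 3
    _ = 8 * c₄ ^ 3 := by ring
    _ ≤ 8 * (A * covol' ^ (-(6 + δ))) := by linarith
    _ ≤ 8 * (A * (κ ^ (-(6 + δ)) * N ^ ((1 + 2 * δ) * (6 + δ)))) :=
        mul_le_mul_of_nonneg_left (mul_le_mul_of_nonneg_left (h3 ▸ h1.trans h2) hA)
          (by norm_num)
    _ ≤ 8 * (A * (κ ^ (-(6 + δ)) * ((2 ^ 10) ^ ((1 + 2 * δ) * (6 + δ)) *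
          R ^ ((1 + 2 * δ) * (6 + δ))))) :=
        mul_le_mul_of_nonneg_left (mul_le_mul_of_nonneg_left
          (mul_le_mul_of_nonneg_left (h5 ▸ h4) hκe) hA) (by norm_num)
    _ = _ := by ring

/-- Sixth roots: `c⁶ ≤ M R^{e}` with `M ≥ 0`, `R ≥ 1`, `e ≤ 6(1+ε)` gives
`c ≤ M^{1/6} R^{1+ε}` for `c ≥ 0`. [folklore] -/
theorem le_of_pow_six_le {c M R e ε : ℝ} (hc : 0 ≤ c) (hM : 0 ≤ M) (hR : 1 ≤ R)
    (he : e ≤ 6 * (1 + ε)) (h : c ^ 6 ≤ M * R ^ e) :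
    c ≤ M ^ (1 / 6 : ℝ) * R ^ (1 + ε) := by
  have hR0 : 0 ≤ R := zero_le_one.trans hR
  have h' : c ^ 6 ≤ M * R ^ (6 * (1 + ε)) :=
    h.trans (mul_le_mul_of_nonneg_left (Real.rpow_le_rpow_of_exponent_le hR he) hM)
  have h6 := Real.rpow_le_rpow (by positivity) h' (by norm_num : (0 : ℝ) ≤ 1 / 6)
  rw [← Real.rpow_natCast c 6, ← Real.rpow_mul hc, Real.mul_rpow hM (by positivity),
    ← Real.rpow_mul hR0] at h6
  norm_num at h6
  rwa [show 6 * (1 + ε) * (1 / 6) = 1 + ε by ring] at h6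

end Arithmetic

/-! ### One Frey pair: degree bound ⟹ covolume bound ⟹ `c₄` bound -/

section FreyPair

open ModularForms CongruenceSubgroup

/-- **The estimates for one Frey pair.** Let `A, B` be coprime with `AB(A+B) ≠ 0`, let
`W₀ / ℤ` be a global minimal equation of the Frey curve `y² = x(x − A)(x + B)`, reached from it by
the change of variables `C` with `|u| ≥ 1` ((12.17) with `u = 1`, or (12.18) with `u = 2`), and
assume the degree bound `deg ≤ C₀ c² N^{2+δ}` for some parametrisation datum of the Frey curve at
level `N = N_E`, the Petersson lower bound `c₂ N^{1−δ} ≤ (f,f)` and Silverman's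
`|c₄|³ ≤ A₀ covol(Λ_Néron)^{−(6+δ)}`. Then, with `covol` the covolume of the datum's lattice and
`covol' = |u|² covol ≥ covol` that of the Néron lattice of `W₀`:
`|c₄(W₀)|³ ≤ max(A₀,1) covol'^{−(6+δ)}` and `covol ≥ (4π² c₂ / max(C₀,1)) N^{−(1+2δ)}`.
(Murty 1999, proof of Thm. 1, as reviewed in Pasten arXiv:1705.09251 §3.) [cite: PastenShimura2024, §3] -/
theorem estimates_of_frey_pair {A B : ℤ} (hAB : IsCoprime A B) (h0 : A * B * (A + B) ≠ 0)
    (W₀ : WeierstrassCurve ℤ) (hmin : ∀ v : HeightOneSpectrum ℤ, (W₀.baseChange ℚ).IsMinimalAt v)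
    (hell : (W₀.baseChange ℚ).IsElliptic) (C : VariableChange ℚ)
    (hCW : C • freyCurve A B = W₀.baseChange ℚ) (hu : 1 ≤ ‖((C.u : ℚ) : ℂ)‖)
    {C₀ c₂ A₀ δ : ℝ}
    (hC₀ : ∀ a b : ℤ, IsCoprime a b → a * b * (a + b) ≠ 0 →
      ∀ (N : ℕ) [NeZero N], (freyCurve a b).conductorNorm ℤ = N →
        ∃ D : ModularParametrizationData (freyCurve a b) N,
          (D.deg : ℝ) ≤ C₀ * (D.c : ℝ) ^ 2 * (N : ℝ) ^ (2 + δ))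
    (hPc : ∀ (N : ℕ) [NeZero N] (W : WeierstrassCurve ℚ) [W.IsElliptic] (f : CuspForm (Gamma0 N) 2),
      IsNewformOf W f → c₂ * (N : ℝ) ^ (1 - δ) ≤ (peterssonProduct (Gamma0 N) 2 f f).re)
    (hA₀ : ∀ (W : WeierstrassCurve ℚ) [W.IsElliptic] [W.IsGloballyMinimal] (L : PeriodPair),
      IsNeronLatticeOf (W.baseChange ℂ) L →
        ((max |W.Δ| (|W.c₄| ^ 3) : ℚ) : ℝ) ≤ A₀ * ZLattice.covolume L.lattice ^ (-(6 + δ))) :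
    ∃ cov cov' : ℝ, 0 < cov ∧ |(W₀.c₄ : ℝ)| ^ 3 ≤ max A₀ 1 * cov' ^ (-(6 + δ)) ∧ cov ≤ cov' ∧
      4 * Real.pi ^ 2 * c₂ / max C₀ 1 *
        (((freyCurve A B).conductorNorm ℤ : ℕ) : ℝ) ^ (-(1 + 2 * δ)) ≤ cov := by
  haveI := isElliptic_freyCurve h0
  haveI := hell
  haveI : (W₀.baseChange ℚ).IsGloballyMinimal := isGloballyMinimal_of_forall_isMinimalAt_int _ hmin
  set N : ℕ := (freyCurve A B).conductorNorm ℤ with hNdef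
  have hN0 : 0 < N := conductorNorm_pos_holds (freyCurve A B)
  haveI : NeZero N := ⟨hN0.ne'⟩
  obtain ⟨D, hD⟩ := hC₀ A B hAB h0 N hNdef.symm
  -- the degree bound with `C₁ = max C₀ 1 > 0`
  have hxy : 0 ≤ (D.c : ℝ) ^ 2 * (N : ℝ) ^ (2 + δ) := by positivity
  have hD' : (D.deg : ℝ) ≤ max C₀ 1 * (D.c : ℝ) ^ 2 * (N : ℝ) ^ (2 + δ) := by
    calc (D.deg : ℝ) ≤ C₀ * (D.c : ℝ) ^ 2 * (N : ℝ) ^ (2 + δ) := hD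
      _ = C₀ * ((D.c : ℝ) ^ 2 * (N : ℝ) ^ (2 + δ)) := by ring
      _ ≤ max C₀ 1 * ((D.c : ℝ) ^ 2 * (N : ℝ) ^ (2 + δ)) :=
          mul_le_mul_of_nonneg_right (le_max_left _ _) hxy
      _ = _ := by ring
  have hPD := hPc N (freyCurve A B) D.f D.isNewformOf
  have hlow := covolume_neronLattice_ge_of_deg_le D (one_pos.trans_le (le_max_right C₀ 1)) hD' hPD
  -- the Néron lattice of the minimal model `W₀ ⊗ ℚ = C • E_{A,B}` is `u · Λ`
  have hL : IsNeronLatticeOf ((freyCurve A B).baseChange ℂ) D.L := D.isNeronLattice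
  set Cc : VariableChange ℂ := C.map (algebraMap ℚ ℂ) with hCc
  have hLs := hL.smul Cc
  have hmap : (C • freyCurve A B).baseChange ℂ = Cc • (freyCurve A B).baseChange ℂ := by
    simp only [hCc, WeierstrassCurve.baseChange, WeierstrassCurve.map_variableChange]
  rw [← hmap, hCW] at hLs
  have hSW := hA₀ (W₀.baseChange ℚ) _ hLs
  set L' : PeriodPair := D.L.mulLeft ((Cc.u : ℂˣ) : ℂ) Cc.u.ne_zero with hL'
  have hcov'0 : 0 < ZLattice.covolume L'.lattice := ZLattice.covolume_pos _ _
  refine ⟨ZLattice.covolume D.L.lattice, ZLattice.covolume L'.lattice, ZLattice.covolume_pos _ _,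
    ?_, ?_, hlow⟩
  · -- `|c₄(W₀)|³ ≤ max(|Δ|, |c₄|³) ≤ A₀ covol'^{-(6+δ)} ≤ max(A₀,1) covol'^{-(6+δ)}`
    have h1 : ((|(W₀.baseChange ℚ).c₄| ^ 3 : ℚ) : ℝ) ≤
        ((max |(W₀.baseChange ℚ).Δ| (|(W₀.baseChange ℚ).c₄| ^ 3) : ℚ) : ℝ) := by
      exact_mod_cast le_max_right _ _
    have hc₄ : (W₀.baseChange ℚ).c₄ = (W₀.c₄ : ℚ) := by
      simp [WeierstrassCurve.baseChange, WeierstrassCurve.map_c₄]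
    have hpos : 0 ≤ ZLattice.covolume L'.lattice ^ (-(6 + δ)) := Real.rpow_nonneg hcov'0.le _
    have key : |(W₀.c₄ : ℝ)| ^ 3 ≤ A₀ * ZLattice.covolume L'.lattice ^ (-(6 + δ)) := by
      have e1 : |(W₀.c₄ : ℝ)| ^ 3 = ((|(W₀.baseChange ℚ).c₄| ^ 3 : ℚ) : ℝ) := by
        rw [hc₄]; norm_cast
      rw [e1]
      exact h1.trans hSW
    exact key.trans (mul_le_mul_of_nonneg_right (le_max_left A₀ 1) hpos)
  · -- `covol ≤ |u|² covol = covol'`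
    rw [hL', PeriodPair.covolume_mulLeft_lattice]
    have hnorm : ((Cc.u : ℂˣ) : ℂ) = ((C.u : ℚ) : ℂ) := by
      simp [hCc, WeierstrassCurve.VariableChange.map_u]
    rw [hnorm]
    have hcov0 : 0 ≤ ZLattice.covolume D.L.lattice := (ZLattice.covolume_pos _ _).le
    have hu2 : 1 ≤ ‖((C.u : ℚ) : ℂ)‖ ^ 2 := one_le_pow₀ hu
    calc ZLattice.covolume D.L.lattice = 1 * ZLattice.covolume D.L.lattice := (one_mul _).symm
      _ ≤ _ := mul_le_mul_of_nonneg_right hu2 hcov0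

end FreyPair

end Literature.NumberTheory.EllipticCurves

end
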